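import Summits.KontsevichZagierPeriods.KontsevichZagierPeriods.Theorems.RootDecompRationalCubeDichotomyRankDescentP07

/-! # `RootDecompRationalCubeDichotomyRankDescentP08` — part 8/14 of the mechanical ≤400-line split of `RankDescent_v12_landing.lean` (sha256 00885b8b9882f02e…)
Source: decomp-kz lens-2 g13 `RankDescent_v12.lean` (HOME/decomp-kz-lens-2/g13/, sha256 00885b8b…; critic g5-18…g5-66 CLEARED as NODE v1–v12 for crux stmt-KontsevichZagierPeriods-26322 RationalCubePiKernelSingle: rank dichotomy single_of_fullRankGeTwo + RankLeOneKernel, de Rham-exact descent, linear-in-one-variable / hyperbola / Fermat–hyperbolic / conic classes, transport kit, Brieskorn module; writer g7 l.1222: «landing split §0–4 ∣ … ∣ §16 --supports 26322 endorsed»); `#print axioms` pins removed; landed by census-1 g9.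
Split by census-1 g9 `gen/splitlean.py`: scopes re-opened with their `open`/`variable`/`set_option` context; mathematics and declaration order unchanged. -/

noncomputable section
open MeasureTheory Set MvPolynomial
open Literature.NumberTheory.Transcendental
open Literature.NumberTheory.Transcendental.KZ
namespace Summit.KontsevichZagierPeriods.RootDecompRationalCubeDichotomy.Rung26322.RankDescent
variable {M : ℕ}

/-- Partial derivatives commute. [folklore] -/
theorem pderiv_comm {m : ℕ} (i j : Fin m) (F : MvPolynomial (Fin m) ℚ) :
    pderiv i (pderiv j F) = pderiv j (pderiv i F) := by
  induction F using MvPolynomial.induction_on' with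
  | monomial s a =>
    by_cases hij : i = j
    · subst hij; rfl
    · simp only [pderiv_monomial]
      rw [tsub_right_comm]
      congr 1
      simp only [Finsupp.tsub_apply, Finsupp.single_apply, if_neg hij, if_neg (Ne.symm hij), tsub_zero]
      ring
  | add p q hp hq => simp only [map_add, hp, hq]

/-- **Transport of an exactness certificate along a substitution** `φ = aeval f`:
`DRExact P Q ⟹ DRExact (φP · Jac f) (φQ)`. [folklore] -/
theorem drExact_transport (f : Fin 2 → MvPolynomial (Fin 2) ℚ) {P Q : MvPolynomial (Fin 2) ℚ} (h : DRExact P Q) :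
    DRExact (aeval f P * (pderiv 0 (f 0) * pderiv 1 (f 1) - pderiv 1 (f 0) * pderiv 0 (f 1))) (aeval f Q) := by
  obtain ⟨s, G, hid⟩ := h
  have hc : ∀ (F : MvPolynomial (Fin 2) ℚ) (i : Fin 2), pderiv i (aeval f F)
      = aeval f (pderiv 0 F) * pderiv i (f 0) + aeval f (pderiv 1 F) * pderiv i (f 1) := by
    intro F i; rw [pderiv_aeval_eq_sum, Fin.sum_univ_two]
  have horig := congrArg (aeval f) hid
  simp only [map_mul, map_pow, map_sum, map_sub, MvPolynomial.aeval_C, MvPolynomial.algebraMap_eq] at horig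
  simp only [Fin.sum_univ_two] at horig
  refine ⟨s, ![aeval f (G 0) * pderiv 1 (f 1) - aeval f (G 1) * pderiv 1 (f 0),
    aeval f (G 1) * pderiv 0 (f 0) - aeval f (G 0) * pderiv 0 (f 1)], ?_⟩
  simp only [Fin.sum_univ_two, Matrix.cons_val_zero, Matrix.cons_val_one, map_sub, Derivation.leibniz,
    smul_eq_mul, hc, pderiv_comm 0 1]
  linear_combination (pderiv 0 (f 0) * pderiv 1 (f 1) - pderiv 1 (f 0) * pderiv 0 (f 1)) * horig

/-- **Shear transport** `x ↦ x + A` (`A` free of `x`, Jacobian 1). [folklore] -/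
theorem drExact_shear (A : MvPolynomial (Fin 2) ℚ) (hA : pderiv 0 A = 0) {P Q : MvPolynomial (Fin 2) ℚ}
    (h : DRExact P Q) : DRExact (aeval ![X 0 + A, X 1] P) (aeval ![X 0 + A, X 1] Q) := by
  have := drExact_transport ![X 0 + A, X 1] h
  simpa [hA, pderiv_one_X_zero, pderiv_zero_X_one] using this

/-- **Permutation transport** (e.g. the swap `x ↔ y`). [folklore] -/
theorem drExact_rename_equiv {m : ℕ} (e : Fin m ≃ Fin m) {P Q : MvPolynomial (Fin m) ℚ} (h : DRExact P Q) :
    DRExact (rename e P) (rename e Q) := by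
  obtain ⟨s, G, hid⟩ := h
  refine ⟨s, fun k => rename e (G (e.symm k)), ?_⟩
  have horig := congrArg (rename e) hid
  simp only [map_mul, map_pow, map_sum, map_sub, rename_C] at horig
  rw [horig]
  symm
  rw [← Equiv.sum_comp e]
  refine Finset.sum_congr rfl fun k _ => ?_
  simp only [Equiv.symm_apply_apply, pderiv_rename e.injective]

/-- The shear fixes polynomials in `y`. [folklore] -/
theorem shear_rename_succ (A : MvPolynomial (Fin 2) ℚ) (A₀ : MvPolynomial (Fin 1) ℚ) :
    aeval ![A, X 1] (rename Fin.succ A₀ : MvPolynomial (Fin 2) ℚ) = rename Fin.succ A₀ := by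
  rw [aeval_rename]
  have : ((![A, X 1] : Fin 2 → MvPolynomial (Fin 2) ℚ) ∘ Fin.succ) = (X ∘ Fin.succ : Fin 1 → MvPolynomial (Fin 2) ℚ) := by
    funext i
    fin_cases i
    rfl
  rw [this]
  have hre : (aeval (X ∘ Fin.succ) : MvPolynomial (Fin 1) ℚ →ₐ[ℚ] MvPolynomial (Fin 2) ℚ) = rename Fin.succ :=
    MvPolynomial.algHom_ext fun i => by simp
  rw [hre]

/-- The two shears `x ↦ x ∓ A(y)` are inverse. [folklore] -/
theorem shear_unshear (A₀ : MvPolynomial (Fin 1) ℚ) (P : MvPolynomial (Fin 2) ℚ) :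
    aeval ![X 0 + rename Fin.succ A₀, X 1] (aeval ![X 0 - rename Fin.succ A₀, X 1] P) = P := by
  rw [← AlgHom.comp_apply, comp_aeval]
  have : (fun i => aeval ![X 0 + rename Fin.succ A₀, X 1] ((![X 0 - rename Fin.succ A₀, X 1] : Fin 2 → _) i))
      = (X : Fin 2 → MvPolynomial (Fin 2) ℚ) := by
    funext i
    fin_cases i
    · show aeval ![X 0 + rename Fin.succ A₀, X 1] (X 0 - rename Fin.succ A₀) = X 0
      rw [map_sub, aeval_X, shear_rename_succ]
      simp
    · show aeval ![X 0 + rename Fin.succ A₀, X 1] (X 1) = X 1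
      simp
  rw [this, aeval_X_left, AlgHom.id_apply]

/-- **x-LINEAR CLASS with leading coefficient `y`**: `Q = a₀ + (x + A₁(y))·y` (`= y·x + A(y)`, `A = a₀ + y·A₁`).
If the functional `diagAlt a₀ (P(x − A₁(y), y))` vanishes then `P/Q` is exact. [folklore] -/
theorem drExact_xlin (a₀ : ℚ) (A₀ : MvPolynomial (Fin 1) ℚ) (P : MvPolynomial (Fin 2) ℚ)
    (h : diagAlt a₀ (aeval ![X 0 - rename Fin.succ A₀, X 1] P) = 0) :
    DRExact P (C a₀ + (X 0 + rename Fin.succ A₀) * X 1) := by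
  have h1 := drExact_hyperbola a₀ _ h
  have h2 := drExact_shear (rename Fin.succ A₀) (pderiv_zero_rename_succ A₀) h1
  rw [shear_unshear] at h2
  have hQ : aeval ![X 0 + rename Fin.succ A₀, X 1] (C a₀ + X 0 * X 1 : MvPolynomial (Fin 2) ℚ)
      = C a₀ + (X 0 + rename Fin.succ A₀) * X 1 := by
    simp [MvPolynomial.algebraMap_eq]
  rwa [hQ] at h2

/-- **DECIDED (m = 2, PROVED, N = 0): x-linear denominators `c·(a₀ + (x + A₁(y))·y)`, functional zero.** [cite: KontsevichZagier2001, §1.2] -/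
theorem xlin_two_mem_relations (c : ℚ) (hc : c ≠ 0) (a₀ : ℚ) (A₀ : MvPolynomial (Fin 1) ℚ)
    (q : IntegralRep 2) (P : MvPolynomial (Fin 2) ℚ)
    (hP : diagAlt a₀ (aeval ![X 0 - rename Fin.succ A₀, X 1] (C c⁻¹ * P)) = 0)
    (hd : q.domain = Set.pi Set.univ (fun _ : Fin 2 => Set.Icc (0:ℝ) 1))
    (hQ : ∀ z ∈ Set.pi Set.univ (fun _ : Fin 2 => Set.Icc (0:ℝ) 1),
      MvPolynomial.aeval z (C c * (C a₀ + (X 0 + rename Fin.succ A₀) * X 1) : MvPolynomial (Fin 2) ℚ) ≠ 0)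
    (hf : ∀ z ∈ Set.pi Set.univ (fun _ : Fin 2 => Set.Icc (0:ℝ) 1),
      q.integrand z = MvPolynomial.aeval z P
        / MvPolynomial.aeval z (C c * (C a₀ + (X 0 + rename Fin.succ A₀) * X 1) : MvPolynomial (Fin 2) ℚ))
    (h0 : q.value = 0) : of q ∈ relations := by
  have hf' := integrand_rescale c hc hf
  have hQ' := zeroFree_rescale c hc hQ
  have hcc : (C c⁻¹ * (C c * (C a₀ + (X 0 + rename Fin.succ A₀) * X 1)) : MvPolynomial (Fin 2) ℚ)
      = C a₀ + (X 0 + rename Fin.succ A₀) * X 1 := by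
    rw [← mul_assoc, ← map_mul, inv_mul_cancel₀ hc, map_one, one_mul]
  rw [hcc] at hf' hQ'
  obtain ⟨s, G, hid⟩ := drExact_xlin a₀ A₀ _ hP
  exact mem_relations_of_exact_two q _ _ s G hid hd hQ' hf' h0

/-- The residual on an x-linear denominator: functional NON-ZERO (one parameter). [folklore] -/
def XLinResidual (c a₀ : ℚ) (A₀ : MvPolynomial (Fin 1) ℚ) : Prop :=
  ∀ (q : IntegralRep 2) (P : MvPolynomial (Fin 2) ℚ),
    diagAlt a₀ (aeval ![X 0 - rename Fin.succ A₀, X 1] (C c⁻¹ * P)) ≠ 0 →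
    q.domain = Set.pi Set.univ (fun _ : Fin 2 => Set.Icc (0:ℝ) 1) →
    (∀ z ∈ Set.pi Set.univ (fun _ : Fin 2 => Set.Icc (0:ℝ) 1),
      MvPolynomial.aeval z (C c * (C a₀ + (X 0 + rename Fin.succ A₀) * X 1) : MvPolynomial (Fin 2) ℚ) ≠ 0) →
    (∀ z ∈ Set.pi Set.univ (fun _ : Fin 2 => Set.Icc (0:ℝ) 1),
      q.integrand z = MvPolynomial.aeval z P
        / MvPolynomial.aeval z (C c * (C a₀ + (X 0 + rename Fin.succ A₀) * X 1) : MvPolynomial (Fin 2) ℚ)) →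
    q.value = 0 → ∃ N : ℕ, (fun y : FormalRep => of piRep * y)^[N] (of q) ∈ relations

/-- **26322 on an x-linear denominator `c(a₀ + (x + A₁(y))y)` ⟸ its one-parameter residual (PROVED split).** [folklore] -/
theorem xlin_single_of_residual (c : ℚ) (hc : c ≠ 0) (a₀ : ℚ) (A₀ : MvPolynomial (Fin 1) ℚ)
    (h : XLinResidual c a₀ A₀) (q : IntegralRep 2) (P : MvPolynomial (Fin 2) ℚ)
    (hd : q.domain = Set.pi Set.univ (fun _ : Fin 2 => Set.Icc (0:ℝ) 1))
    (hQ : ∀ z ∈ Set.pi Set.univ (fun _ : Fin 2 => Set.Icc (0:ℝ) 1),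
      MvPolynomial.aeval z (C c * (C a₀ + (X 0 + rename Fin.succ A₀) * X 1) : MvPolynomial (Fin 2) ℚ) ≠ 0)
    (hf : ∀ z ∈ Set.pi Set.univ (fun _ : Fin 2 => Set.Icc (0:ℝ) 1),
      q.integrand z = MvPolynomial.aeval z P
        / MvPolynomial.aeval z (C c * (C a₀ + (X 0 + rename Fin.succ A₀) * X 1) : MvPolynomial (Fin 2) ℚ))
    (h0 : q.value = 0) : ∃ N : ℕ, (fun y : FormalRep => of piRep * y)^[N] (of q) ∈ relations := by
  by_cases hP : diagAlt a₀ (aeval ![X 0 - rename Fin.succ A₀, X 1] (C c⁻¹ * P)) = 0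
  · exact ⟨0, by simpa using xlin_two_mem_relations c hc a₀ A₀ q P hP hd hQ hf h0⟩
  · exact h q P hP hd hQ hf h0

/-- **Swapped orientation** (`y`-linear with leading coefficient `x`): transport by `x ↔ y`. [folklore] -/
theorem drExact_ylin (a₀ : ℚ) (A₀ : MvPolynomial (Fin 1) ℚ) (P : MvPolynomial (Fin 2) ℚ)
    (h : diagAlt a₀ (aeval ![X 0 - rename Fin.succ A₀, X 1] (rename (Equiv.swap (0 : Fin 2) 1) P)) = 0) :
    DRExact P (rename (Equiv.swap (0 : Fin 2) 1) (C a₀ + (X 0 + rename Fin.succ A₀) * X 1)) := by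
  have h1 := drExact_rename_equiv (Equiv.swap (0 : Fin 2) 1) (drExact_xlin a₀ A₀ _ h)
  have hP : rename (Equiv.swap (0 : Fin 2) 1) (rename (Equiv.swap (0 : Fin 2) 1) P) = P := by
    rw [rename_rename]
    have : ((Equiv.swap (0 : Fin 2) 1) ∘ (Equiv.swap (0 : Fin 2) 1) : Fin 2 → Fin 2) = id := by
      funext i; simp [Equiv.swap_apply_self]
    rw [this, rename_id, AlgHom.id_apply]
  rwa [hP] at h1

/-! ### §10b Census instances (census-m2-v1, box of 996 zero-free `Q`): the `π²` value class is x- or y-linear with monomial leading coefficient.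
`1 + xy + y² = 1·(1 + (x + y)·y)` (`c = 1, a₀ = 1, A₁ = y`); `1 + 2xy + y² = 2·(½ + (x + y/2)·y)`; `1 + y + xy + y² =
1·(1 + (x + 1 + y)·y)`; `1 + y + xy = 1·(1 + (x + 1)·y)` (dilog class); and, swapped, `1 − x + x² + xy`, `1 − x + x² + 2xy`.
The decided codimension-one numerator class on each is `{P : diagAlt a₀ (P(x − A₁(y), y)/c) = 0}`; e.g.: -/

/-- `(x + y)/(1 + xy + y²)` is exact (decided, `N = 0`): the functional of `x + y` on `1 + (x + y)y` vanishes. [folklore] -/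
example : diagAlt 1 (aeval ![X 0 - rename Fin.succ (X 0 : MvPolynomial (Fin 1) ℚ), X 1]
    (C (1:ℚ)⁻¹ * (X 0 + X 1 : MvPolynomial (Fin 2) ℚ))) = 0 := by
  simp [rename_X, diagAlt_X]

/-- … while the functional of `1` on `1 + (x + y)y` is `1` (the one-parameter residual: the value of
`∫∫ dx dy/(1 + xy + y²)`, census class `π²`). [folklore] -/
example : diagAlt 1 (aeval ![X 0 - rename Fin.succ (X 0 : MvPolynomial (Fin 1) ℚ), X 1]
    (C (1:ℚ)⁻¹ * (1 : MvPolynomial (Fin 2) ℚ))) = 1 := by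
  rw [inv_one, mul_one, MvPolynomial.aeval_C, MvPolynomial.algebraMap_eq, diagAlt_C]

/-- Auxiliary step `diagAlt_X_pow` (§10b): diag Alt X pow. [bookkeeping] -/
theorem diagAlt_X_pow (q₀ : ℚ) (k : Fin 2) {c : ℕ} (hc : c ≠ 0) :
    diagAlt q₀ (X k ^ c : MvPolynomial (Fin 2) ℚ) = 0 := by
  rw [X_pow_eq_monomial, diagAlt_monomial]
  fin_cases k <;> simp [diagFn, hc, Ne.symm hc]

/-- `x²/(1 + xy + y²) ≡ 2·1`: the functional of `x²` is `diagAlt 1 ((x − y)²) = diagAlt 1 (x² − 2xy + y²) = 2`, so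
`(x² − 2)/(1 + xy + y²)` is exact (decided). [folklore] -/
example : diagAlt 1 (aeval ![X 0 - rename Fin.succ (X 0 : MvPolynomial (Fin 1) ℚ), X 1]
    (C (1:ℚ)⁻¹ * (X 0 ^ 2 - C 2 : MvPolynomial (Fin 2) ℚ))) = 0 := by
  have h : (aeval ![X 0 - rename Fin.succ (X 0 : MvPolynomial (Fin 1) ℚ), X 1]
      (C (1:ℚ)⁻¹ * (X 0 ^ 2 - C 2 : MvPolynomial (Fin 2) ℚ)))
      = X 0 ^ 2 - C 2 * (X 0 * X 1) + X 1 ^ 2 - C 2 := by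
    simp [rename_X, MvPolynomial.algebraMap_eq]
    simp only [map_ofNat]
    ring
  rw [h, diagAlt_sub, diagAlt_add, diagAlt_sub, diagAlt_C_mul, diagAlt_XX, diagAlt_C,
    diagAlt_X_pow 1 0 two_ne_zero, diagAlt_X_pow 1 1 two_ne_zero]
  ring

/-! ## §11 (v7) TRANSLATED SHEARS: every `Q` of `x`-degree one with LINEAR leading coefficient — `Q = B(y)·x + A(y)`, `deg B ≤ 1`

`(x, y) ↦ (x + A₁(y), y + β)` has Jacobian 1 (`drExact_shearT`). It carries the hyperbola `a₀ + w·v` onto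
`Q = a₀ + (x + A₁(y))·(y + β)` — the IRREDUCIBLE x-linear curves with leading coefficient `y + β` (`A(−β) = a₀ ≠ 0`) —
and the grid `w·v` onto `Q = (x + A₁(y))·(y + β)` — the REDUCIBLE ones (line × graph; `A(−β) = 0`), whose functional is the value of
the unsheared numerator at the origin (corner criterion of §7). Together with §6 (`B` constant: everything exact) this classifies EVERY
denominator `Q = B(y)x + A(y)` with `deg B ≤ 1` — in particular every `Q` of the census box (total degree ≤ 2) having `x`-degree ≤ 1
or, by the swap, `y`-degree ≤ 1: decided codimension ≤ 1 numerator class + at most ONE rational parameter each. -/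

/-- `A₀(t)`: the one-variable polynomial `A₀` evaluated at `t ∈ ℚ[x,y]`. -/
def evalAt (A₀ : MvPolynomial (Fin 1) ℚ) (t : MvPolynomial (Fin 2) ℚ) : MvPolynomial (Fin 2) ℚ :=
  aeval (fun _ : Fin 1 => t) A₀

/-- Algebra maps commute with `evalAt`. [folklore] -/
theorem map_evalAt (φ : MvPolynomial (Fin 2) ℚ →ₐ[ℚ] MvPolynomial (Fin 2) ℚ) (A₀ : MvPolynomial (Fin 1) ℚ)
    (t : MvPolynomial (Fin 2) ℚ) : φ (evalAt A₀ t) = evalAt A₀ (φ t) := by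
  unfold evalAt
  rw [← AlgHom.comp_apply, comp_aeval]

/-- `A₀(y + b)` is free of `x`. [folklore] -/
theorem pderiv_zero_evalAt (A₀ : MvPolynomial (Fin 1) ℚ) (b : ℚ) :
    pderiv 0 (evalAt A₀ (X 1 + C b)) = 0 := by
  unfold evalAt
  rw [pderiv_aeval_eq_sum, Fin.sum_univ_one]
  simp

/-- **Translated shear transport** `(x, y) ↦ (x + A(y), y + β)` (Jacobian 1). [folklore] -/
theorem drExact_shearT (A : MvPolynomial (Fin 2) ℚ) (hA : pderiv 0 A = 0) (β : ℚ) {P Q : MvPolynomial (Fin 2) ℚ}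
    (h : DRExact P Q) : DRExact (aeval ![X 0 + A, X 1 + C β] P) (aeval ![X 0 + A, X 1 + C β] Q) := by
  have := drExact_transport ![X 0 + A, X 1 + C β] h
  simpa [hA, pderiv_one_X_zero, pderiv_zero_X_one] using this

/-- `σ ∘ τ = id` for `σ = (x + A₀(y), y + β)`, `τ = (x − A₀(y − β), y − β)`. [folklore] -/
theorem shearT_unshearT (A₀ : MvPolynomial (Fin 1) ℚ) (β : ℚ) (P : MvPolynomial (Fin 2) ℚ) :
    aeval ![X 0 + evalAt A₀ (X 1 + C 0), X 1 + C β]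
      (aeval ![X 0 - evalAt A₀ (X 1 + C (-β)), X 1 + C (-β)] P) = P := by
  have e1 : aeval ![X 0 + evalAt A₀ (X 1 + C 0), X 1 + C β] (X 1 + C (-β) : MvPolynomial (Fin 2) ℚ) = X 1 + C 0 := by
    simp [MvPolynomial.algebraMap_eq]
  rw [← AlgHom.comp_apply, comp_aeval]
  have : (fun i => aeval ![X 0 + evalAt A₀ (X 1 + C 0), X 1 + C β]
      ((![X 0 - evalAt A₀ (X 1 + C (-β)), X 1 + C (-β)] : Fin 2 → _) i)) = (X : Fin 2 → MvPolynomial (Fin 2) ℚ) := by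
    funext i
    fin_cases i
    · show aeval ![X 0 + evalAt A₀ (X 1 + C 0), X 1 + C β] (X 0 - evalAt A₀ (X 1 + C (-β))) = X 0
      rw [map_sub, aeval_X, map_evalAt, e1]
      simp
    · show aeval ![X 0 + evalAt A₀ (X 1 + C 0), X 1 + C β] (X 1 + C (-β)) = X 1
      rw [e1, map_zero, add_zero]
  rw [this, aeval_X_left, AlgHom.id_apply]

/-- **IRREDUCIBLE x-linear class** `Q = a₀ + (x + A₁(y))·(y + β)` (`= (y + β)·x + A(y)`, `A(−β) = a₀`): functional
`P ↦ diagAlt a₀ (P(x − A₁(y − β), y − β))`; zero ⟹ exact. [folklore] -/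
theorem drExact_xlinT (a₀ β : ℚ) (A₀ : MvPolynomial (Fin 1) ℚ) (P : MvPolynomial (Fin 2) ℚ)
    (h : diagAlt a₀ (aeval ![X 0 - evalAt A₀ (X 1 + C (-β)), X 1 + C (-β)] P) = 0) :
    DRExact P (C a₀ + (X 0 + evalAt A₀ (X 1 + C 0)) * (X 1 + C β)) := by
  have h1 := drExact_hyperbola a₀ _ h
  have h2 := drExact_shearT (evalAt A₀ (X 1 + C 0)) (pderiv_zero_evalAt A₀ 0) β h1
  rw [shearT_unshearT] at h2
  have hQ : aeval ![X 0 + evalAt A₀ (X 1 + C 0), X 1 + C β] (C a₀ + X 0 * X 1 : MvPolynomial (Fin 2) ℚ)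
      = C a₀ + (X 0 + evalAt A₀ (X 1 + C 0)) * (X 1 + C β) := by
    simp [MvPolynomial.algebraMap_eq]
  rwa [hQ] at h2

/-- **REDUCIBLE x-linear class** (line × graph) `Q = (x + A₁(y))·(y + β)`: functional = the unsheared numerator at the
origin, `P ↦ (P(x − A₁(y − β), y − β))(0, 0) = P(−A₁(−β), −β)`; zero ⟹ exact (corner criterion §7 transported). [folklore] -/
theorem drExact_lineGraph (β : ℚ) (A₀ : MvPolynomial (Fin 1) ℚ) (P : MvPolynomial (Fin 2) ℚ)
    (h : MvPolynomial.eval ![(0:ℚ), 0] (aeval ![X 0 - evalAt A₀ (X 1 + C (-β)), X 1 + C (-β)] P) = 0) :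
    DRExact P ((X 0 + evalAt A₀ (X 1 + C 0)) * (X 1 + C β)) := by
  have h' : MvPolynomial.eval ![-(0:ℚ), -0] (aeval ![X 0 - evalAt A₀ (X 1 + C (-β)), X 1 + C (-β)] P) = 0 := by
    rw [neg_zero]; exact h
  have h1 := drExact_of_corner 0 0 _ h'
  have h2 := drExact_shearT (evalAt A₀ (X 1 + C 0)) (pderiv_zero_evalAt A₀ 0) β h1
  rw [shearT_unshearT] at h2
  have hQ : aeval ![X 0 + evalAt A₀ (X 1 + C 0), X 1 + C β] ((X 0 + C 0) * (X 1 + C 0) : MvPolynomial (Fin 2) ℚ)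
      = (X 0 + evalAt A₀ (X 1 + C 0)) * (X 1 + C β) := by
    simp
  rwa [hQ] at h2

/-- **DECIDED (m = 2, PROVED, N = 0): irreducible x-linear denominators `c·(a₀ + (x + A₁(y))(y + β))`, functional zero.** [cite: KontsevichZagier2001, §1.2] -/
theorem xlinT_two_mem_relations (c : ℚ) (hc : c ≠ 0) (a₀ β : ℚ) (A₀ : MvPolynomial (Fin 1) ℚ)
    (q : IntegralRep 2) (P : MvPolynomial (Fin 2) ℚ)
    (hP : diagAlt a₀ (aeval ![X 0 - evalAt A₀ (X 1 + C (-β)), X 1 + C (-β)] (C c⁻¹ * P)) = 0)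
    (hd : q.domain = Set.pi Set.univ (fun _ : Fin 2 => Set.Icc (0:ℝ) 1))
    (hQ : ∀ z ∈ Set.pi Set.univ (fun _ : Fin 2 => Set.Icc (0:ℝ) 1),
      MvPolynomial.aeval z (C c * (C a₀ + (X 0 + evalAt A₀ (X 1 + C 0)) * (X 1 + C β)) : MvPolynomial (Fin 2) ℚ) ≠ 0)
    (hf : ∀ z ∈ Set.pi Set.univ (fun _ : Fin 2 => Set.Icc (0:ℝ) 1),
      q.integrand z = MvPolynomial.aeval z P
        / MvPolynomial.aeval z (C c * (C a₀ + (X 0 + evalAt A₀ (X 1 + C 0)) * (X 1 + C β)) : MvPolynomial (Fin 2) ℚ))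
    (h0 : q.value = 0) : of q ∈ relations := by
  have hf' := integrand_rescale c hc hf
  have hQ' := zeroFree_rescale c hc hQ
  have hcc : (C c⁻¹ * (C c * (C a₀ + (X 0 + evalAt A₀ (X 1 + C 0)) * (X 1 + C β))) : MvPolynomial (Fin 2) ℚ)
      = C a₀ + (X 0 + evalAt A₀ (X 1 + C 0)) * (X 1 + C β) := by
    rw [← mul_assoc, ← map_mul, inv_mul_cancel₀ hc, map_one, one_mul]
  rw [hcc] at hf' hQ'
  obtain ⟨s, G, hid⟩ := drExact_xlinT a₀ β A₀ _ hP
  exact mem_relations_of_exact_two q _ _ s G hid hd hQ' hf' h0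

end Summit.KontsevichZagierPeriods.RootDecompRationalCubeDichotomy.Rung26322.RankDescent
end
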